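import Mathlib

/-!
# Abel's identity and the Liouville normalisation for `u'' = p u' + q u`

Solo-blind programme (steady zeroth law, paper §24.37(6), (6′)): on the dead side of the landing
layer the linearised amplitude operator is REAL, and across a "window" between two potential wells
the only non-self-adjoint datum a real second-order problem can carry is the scalar
`exp (∫ p)` multiplying the Wronskian (Abel–Liouville); it is removed exactly by the Liouville
weight `e^{φ}`, `φ' = p / 2`, which turns `u'' = p u' + q u` into the weightless equation
`w'' = (q + p² / 4 - p' / 2) w`.  This file proves these two classical facts in the scalar
`HasDerivAt` phrasing:

* `hasDerivAt_wronskian` — along two solutions the Wronskian `W = u v' - u' v` satisfies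
  `W' = p W`;
* `abel_identity` — `W t = W t₀ · exp (∫_{t₀}^{t} p)` (Abel's identity);
* `abs_wronskian_le_of_integral_le`, `abs_wronskian_ge_of_integral_le` — hence
  `|W t₀| e^{-C} ≤ |W t| ≤ |W t₀| e^{C}` whenever `|∫_{t₀}^{t} p| ≤ C`: the "determinant of the
  connection" is controlled by the integrated odd coefficient alone;
* `liouville_normalisation` — if `φ' = p/2` and `p` is differentiable, then `w = e^{-φ} u` solves
  `w'' = (q + p²/4 - p'/2) w` (no first-order term).

All statements are elementary calculus; no sorry, no new axioms.
-/

namespace Summit.AnomalousDissipation.AnomalousDissipation.Theorems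

open Real intervalIntegral

/-- The Wronskian of two solutions of `u'' = p u' + q u` has derivative `p · W`. -/
theorem hasDerivAt_wronskian {p q u u' v v' : ℝ → ℝ} {t : ℝ}
    (hu : HasDerivAt u (u' t) t) (hu' : HasDerivAt u' (p t * u' t + q t * u t) t)
    (hv : HasDerivAt v (v' t) t) (hv' : HasDerivAt v' (p t * v' t + q t * v t) t) :
    HasDerivAt (fun s => u s * v' s - u' s * v s) (p t * (u t * v' t - u' t * v t)) t := by
  have h : HasDerivAt (fun s => u s * v' s - u' s * v s)
      (u' t * v' t + u t * (p t * v' t + q t * v t)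
        - ((p t * u' t + q t * u t) * v t + u' t * v' t)) t :=
    (hu.mul hv').sub (hu'.mul hv)
  exact h.congr_deriv (by ring)

/-- **Abel's identity.** For two solutions of `u'' = p u' + q u` on `ℝ` with `p` continuous,
`W(t) = W(t₀) · exp (∫_{t₀}^{t} p)`. -/
theorem abel_identity {p q u u' v v' : ℝ → ℝ} (hp : Continuous p)
    (hu : ∀ t, HasDerivAt u (u' t) t) (hu' : ∀ t, HasDerivAt u' (p t * u' t + q t * u t) t)
    (hv : ∀ t, HasDerivAt v (v' t) t) (hv' : ∀ t, HasDerivAt v' (p t * v' t + q t * v t) t)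
    (t₀ t : ℝ) :
    u t * v' t - u' t * v t
      = (u t₀ * v' t₀ - u' t₀ * v t₀) * Real.exp (∫ s in t₀..t, p s) := by
  -- `F s := W s · exp (-(∫_{t₀}^{s} p))` has zero derivative, hence is constant.
  set W : ℝ → ℝ := fun s => u s * v' s - u' s * v s with hW
  set I : ℝ → ℝ := fun s => ∫ x in t₀..s, p x with hI
  have hIder : ∀ s, HasDerivAt I (p s) s := fun s =>
    (hp.integral_hasStrictDerivAt t₀ s).hasDerivAt
  have hWder : ∀ s, HasDerivAt W (p s * W s) s := fun s =>
    hasDerivAt_wronskian (hu s) (hu' s) (hv s) (hv' s)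
  have hEder : ∀ s, HasDerivAt (fun r => Real.exp (-I r)) (Real.exp (-I s) * (-p s)) s :=
    fun s => (hIder s).neg.exp
  have hFder : ∀ s, HasDerivAt (fun r => W r * Real.exp (-I r)) 0 s := by
    intro s
    have h : HasDerivAt (fun r => W r * Real.exp (-I r))
        (p s * W s * Real.exp (-I s) + W s * (Real.exp (-I s) * (-p s))) s :=
      (hWder s).mul (hEder s)
    exact h.congr_deriv (by ring)
  have hFdiff : Differentiable ℝ (fun r => W r * Real.exp (-I r)) :=
    fun s => (hFder s).differentiableAt
  have hFconst := is_const_of_deriv_eq_zero hFdiff (fun s => (hFder s).deriv) t t₀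
  -- unpack: W t · exp(-I t) = W t₀ · exp(-I t₀) = W t₀
  have hI0 : I t₀ = 0 := by simp [hI]
  have h1 : W t * Real.exp (-I t) = W t₀ := by
    simpa [hI0] using hFconst
  have h2 : W t = W t₀ * Real.exp (I t) := by
    have hpos : Real.exp (-I t) ≠ 0 := (Real.exp_pos _).ne'
    have : W t = W t₀ / Real.exp (-I t) := by
      rw [eq_div_iff hpos]; exact h1
    rw [this, Real.exp_neg, div_inv_eq_mul]
  simpa [hW, hI] using h2

/-- Upper bound from Abel's identity: if `|∫_{t₀}^{t} p| ≤ C` then `|W t| ≤ |W t₀| · e^{C}`. -/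
theorem abs_wronskian_le_of_integral_le {p q u u' v v' : ℝ → ℝ} (hp : Continuous p)
    (hu : ∀ t, HasDerivAt u (u' t) t) (hu' : ∀ t, HasDerivAt u' (p t * u' t + q t * u t) t)
    (hv : ∀ t, HasDerivAt v (v' t) t) (hv' : ∀ t, HasDerivAt v' (p t * v' t + q t * v t) t)
    {t₀ t C : ℝ} (hC : |∫ s in t₀..t, p s| ≤ C) :
    |u t * v' t - u' t * v t| ≤ |u t₀ * v' t₀ - u' t₀ * v t₀| * Real.exp C := by
  rw [abel_identity hp hu hu' hv hv' t₀ t, abs_mul, Real.abs_exp]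
  gcongr
  exact (le_abs_self _).trans hC

/-- Lower bound from Abel's identity: if `|∫_{t₀}^{t} p| ≤ C` then `|W t₀| · e^{-C} ≤ |W t|`. -/
theorem abs_wronskian_ge_of_integral_le {p q u u' v v' : ℝ → ℝ} (hp : Continuous p)
    (hu : ∀ t, HasDerivAt u (u' t) t) (hu' : ∀ t, HasDerivAt u' (p t * u' t + q t * u t) t)
    (hv : ∀ t, HasDerivAt v (v' t) t) (hv' : ∀ t, HasDerivAt v' (p t * v' t + q t * v t) t)
    {t₀ t C : ℝ} (hC : |∫ s in t₀..t, p s| ≤ C) :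
    |u t₀ * v' t₀ - u' t₀ * v t₀| * Real.exp (-C) ≤ |u t * v' t - u' t * v t| := by
  rw [abel_identity hp hu hu' hv hv' t₀ t, abs_mul, Real.abs_exp]
  gcongr
  have := neg_abs_le (∫ s in t₀..t, p s)
  linarith

/-- **Liouville normalisation.** If `u'' = p u' + q u` at `t`, `φ' = p/2` at `t` and `p` has
derivative `p₁` at `t`, then `w = e^{-φ} u`, with `w' = e^{-φ}(u' - (p/2) u)`, satisfies
`w'' = (q + p²/4 - p₁/2) · w` at `t`: the first-order term is gone. Stated as the two `HasDerivAt`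
facts for `w` and `w'`. -/
theorem liouville_normalisation {p p₁ q u u' φ : ℝ → ℝ} {t : ℝ}
    (hu : HasDerivAt u (u' t) t) (hu' : HasDerivAt u' (p t * u' t + q t * u t) t)
    (hφ : HasDerivAt φ (p t / 2) t) (hp : HasDerivAt p (p₁ t) t) :
    HasDerivAt (fun s => Real.exp (-φ s) * u s)
        (Real.exp (-φ t) * (u' t - p t / 2 * u t)) t ∧
      HasDerivAt (fun s => Real.exp (-φ s) * (u' s - p s / 2 * u s))
        ((q t + p t ^ 2 / 4 - p₁ t / 2) * (Real.exp (-φ t) * u t)) t := by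
  have hE : HasDerivAt (fun s => Real.exp (-φ s)) (Real.exp (-φ t) * (-(p t / 2))) t :=
    hφ.neg.exp
  refine ⟨?_, ?_⟩
  · have h : HasDerivAt (fun s => Real.exp (-φ s) * u s)
        (Real.exp (-φ t) * (-(p t / 2)) * u t + Real.exp (-φ t) * u' t) t :=
      hE.mul hu
    exact h.congr_deriv (by ring)
  · have hinner : HasDerivAt (fun s => u' s - p s / 2 * u s)
        (p t * u' t + q t * u t - (p₁ t / 2 * u t + p t / 2 * u' t)) t :=
      hu'.sub ((hp.div_const 2).mul hu)
    have h : HasDerivAt (fun s => Real.exp (-φ s) * (u' s - p s / 2 * u s))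
        (Real.exp (-φ t) * (-(p t / 2)) * (u' t - p t / 2 * u t)
          + Real.exp (-φ t) * (p t * u' t + q t * u t - (p₁ t / 2 * u t + p t / 2 * u' t))) t :=
      hE.mul hinner
    exact h.congr_deriv (by ring)

end Summit.AnomalousDissipation.AnomalousDissipation.Theorems
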